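import Literature.Barriers.HubbardSuperconductivity.SignProblemNPHardMachines
import Literature.Computability.Complexity.CanonicalCodes
import Literature.Computability.Complexity.ListFoldBricks
import Literature.Computability.Complexity.ZIntBricks
import Literature.Computability.Complexity.PlumbingBricks
import Literature.Computability.Complexity.IntVectorBricks
import Literature.Computability.Complexity.NPClosureProofs
import Literature.Computability.Complexity.StringCopy
import HarnessLib

/-!
# `ISINGGROUND ∈ NP`: the instance-code test and the energy verifier in `P`

Support file for the discharge of `isingGround_isNPComplete` (`SignProblemNPHard.lean`, after
Barahona 1982 [cite: Barahona1982, §4.2, Theorem (P3 is NP-hard), p. 19]; assembled in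
`SignProblemNPHardProofs.lean`). The membership half, "guess the spin configuration `σ` and
evaluate `E_J(σ) = -Σ_{i<j} J_{ij} s_i s_j`" (Troyer–Wiese: the question "whether there is a spin
configuration with energy `≤ E₀`" is in `NP` [cite: TroyerWiese2005, Letter p. 4]), is proved here
for the tree's language `ISINGGROUND = code '' isingGroundSet` at the machine level (Mathlib's `TM2`
through the tree's algebra of `FP` string functions; no machine is written):

* **The instance-code test** `instCodeFn ∈ FP` (one bit): a string `x` is the
  `encodingIntMatrix.pairBool encodingIntBool`-code of SOME instance `(⟨n, J⟩, K)` iff it is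
  well paired, its second component is a canonical integer code (`CanonCode.canonIntFn` fixes it),
  its first component `a` is well paired with a canonical numeral `encodeNat n` in front
  (`Brick.canonF` fixes it), a canonical `listBool` code of integers behind
  (`CanonCode.canonListFn canonIntFn` fixes it) whose unary header has length `n²`
  (`instCodeFn_eq_true_iff`). A language defined as an IMAGE `encode '' S` needs this test: a
  verifier must reject non-codewords.
* **The unit-coupling test** `unitCouplingFn` (`Brick.allFn` over the entry codes: each is the code of
  `0`, `1` or `-1`); `goodInstLang = {x | instCodeFn x ∧ unitCouplingFn x} ∈ P` is exactly the set of codes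
  of unit-coupling instances (`mem_goodInstLang_iff`).
* **The energy verifier** `isingVerifFn ∈ FP` on `⟨x, y⟩`: the witness `y` is read TOTALLY as the
  configuration `σ_y i = y[i]` (default `false`); a fold (`Brick.foldLoop` with `Brick.iaddFn` on
  difference pairs) over the flat index `t = i n + j < n²` (`Plumb.divModFn`) adds the term
  `-J_{ij} s_i s_j` (entry read by index, `PRelSigPi.elemFn`, converted by `Brick.ofSMFn`, negated by
  `Brick.zswapF` when `y[i] = y[j]`) for `i < j`; the verdict is `[E_J(σ_y) ≤ K]` (`Brick.zleF`).
  Its exact value on the code of ANY instance paired with ANY string is `isingVerifFn_encode`.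
* **Assembly** `isingGround_mem_NP`: `ISINGGROUND = goodInstLang ⊓ {x | ∃ y, |y| ≤ |x| ∧ ⟨x, y⟩
  accepted}` (witness `List.ofFn σ`, of length `n ≤ |x|`), an intersection of a `P` language with
  a language in certificate form (`inter_P_mem_polyExists`).

## References

* F. Barahona, J. Phys. A 15 (1982) 3241–3253, §4.2 (Theorem: P3 is NP-hard).
* M. Troyer, U.-J. Wiese, PRL 94 (2005) 170201, Letter p. 4 (the NP-complete decision problem).
* S. Arora, B. Barak, *Computational Complexity: A Modern Approach*, CUP 2009, Def. 2.1 (`NP` by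
  certificates), §0.1 (codes), §1.3 (closure of polynomial time under composition and bounded
  loops).
-/

noncomputable section

namespace Literature.Barriers.HubbardSuperconductivity

open _root_.Computability Literature.Computability.Complexity Literature.Computability.Complexity.Nondeterministic
  Brick OracleCompose PRelSigPi Plumb HashBricks CanonCode Polynomial Finset

/-! ### The instance coding, field by field -/

/-- The coding of `ISINGGROUND` instances `(⟨n, J⟩, K)`. [cite: AroraBarak2009, §0.1] -/
abbrev instEnc : Encoding ((Σ n, Matrix (Fin n) (Fin n) ℤ) × ℤ) Bool :=
  encodingIntMatrix.pairBool encodingIntBool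

/-- `ISINGGROUND` is the image of `isingGroundSet` under `instEnc`. [folklore] -/
theorem isingGround_eq_image : ISINGGROUND = instEnc.encode '' isingGroundSet := rfl

/-- The row-major list of entry codes of an `n × n` integer matrix. [cite: AroraBarak2009, §0.1] -/
def entryList (n : ℕ) (J : Matrix (Fin n) (Fin n) ℤ) : List (List Bool) :=
  List.ofFn fun m : Fin (n * n) => encodingIntBool.encode (J m.divNat m.modNat)

/-- The row-major list has `n²` entries. [folklore] -/
@[simp] theorem length_entryList (n : ℕ) (J : Matrix (Fin n) (Fin n) ℤ) : (entryList n J).length = n * n := by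
  simp [entryList]

/-- The code of a matrix: unary header `1^{n²}`, then the body of the row-major entry codes.
[cite: AroraBarak2009, §0.1] -/
theorem encodingIntMatrixFin_encode_eq (n : ℕ) (J : Matrix (Fin n) (Fin n) ℤ) :
    (Literature.Algebra.EuclideanLattices.encodingIntMatrixFin n).encode J = boolPair (ones (n * n)) (body (entryList n J)) := by
  change encodingIntBool.listBool.encode (List.ofFn fun m : Fin (n * n) => J m.divNat m.modNat) = _
  rw [CNFIsing.listBool_encode_eq_boolPair, List.length_ofFn, List.map_ofFn]
  rfl

/-- **The code of an instance, field by field**: `⟨⟨encodeNat n, ⟨1^{n²}, body entries⟩⟩, code K⟩`.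
[cite: AroraBarak2009, §0.1] -/
theorem instEnc_encode_eq (n : ℕ) (J : Matrix (Fin n) (Fin n) ℤ) (K : ℤ) :
    instEnc.encode (⟨n, J⟩, K) =
      boolPair (boolPair (encodeNat n) (boolPair (ones (n * n)) (body (entryList n J)))) (encodingIntBool.encode K) := by
  change boolPair (encodingIntMatrix.encode ⟨n, J⟩) (encodingIntBool.encode K) = _
  rw [encodingIntMatrix_encode, encodingIntMatrixFin_encode_eq]

/-- Entries of the row-major list: position `t < n²` holds the code of `J (t / n) (t % n)`. [folklore] -/
theorem getD_entryList {n : ℕ} (J : Matrix (Fin n) (Fin n) ℤ) {t : ℕ} (ht : t < n * n) :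
    (entryList n J).getD t [] =
      encodingIntBool.encode (J ⟨t / n, Nat.div_lt_of_lt_mul (by rwa [Nat.mul_comm])⟩
        ⟨t % n, Nat.mod_lt _ (Nat.pos_of_ne_zero fun h => by simp [h] at ht)⟩) := by
  rw [List.getD_eq_getElem _ _ (by simpa using ht)]
  simp [entryList, Fin.divNat, Fin.modNat]

/-- `n² ≤ |code (⟨n, J⟩, K)|` (the unary header alone has `n²` symbols). [folklore] -/
theorem le_length_instEnc_encode (n : ℕ) (J : Matrix (Fin n) (Fin n) ℤ) (K : ℤ) :
    n * n ≤ (instEnc.encode (⟨n, J⟩, K)).length := by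
  rw [instEnc_encode_eq]
  simp only [length_boolPair, List.length_replicate]
  nlinarith

/-! ### One-bit tests and their values -/

/-- Conjunction of decided propositions. [folklore] -/
theorem andFn_decide {c d : List Bool → List Bool} {z : List Bool} {P Q : Prop} [Decidable P] [Decidable Q]
    (h : c z = [decide P]) (h' : d z = [decide Q]) : andFn c d z = [decide (P ∧ Q)] := by
  rw [andFn_apply h h', Bool.decide_and]

/-- **Well-pairedness test** `wpF u = [⟨fst u, snd u⟩ = u]` (`u` is in the range of `boolPair`).
[cite: AroraBarak2009, §0.1] -/
def wpF : List Bool → List Bool := eqPairFn ∘ fanoutFn (fanoutFn fstF sndF) id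

/-- `wpF ∈ FP`. [cite: AroraBarakCC2009, §1.3] -/
theorem wpF_mem_FP : wpF ∈ FP :=
  comp_mem_FP eqPairFn_mem_FP (fanoutFn_mem_FP (fanoutFn_mem_FP fstF_mem_FP sndF_mem_FP) id_mem_FP)

/-- Value of `wpF`. [folklore] -/
theorem wpF_apply (u : List Bool) : wpF u = [decide (boolPair (fstF u) (sndF u) = u)] := by
  simp [wpF, eqPairFn_boolPair]

/-- `wpF` is one-bit. [folklore] -/
theorem oneBit_wpF : OneBit wpF := fun u => ⟨_, wpF_apply u⟩

/-- **Fixed-point test** `fixF g u = [g u = u]` of a string function `g` (a canonicaliser). [folklore] -/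
def fixF (g : List Bool → List Bool) : List Bool → List Bool := eqPairFn ∘ fanoutFn g id

/-- `fixF g ∈ FP` for `g ∈ FP`. [cite: AroraBarakCC2009, §1.3] -/
theorem fixF_mem_FP {g : List Bool → List Bool} (hg : g ∈ FP) : fixF g ∈ FP :=
  comp_mem_FP eqPairFn_mem_FP (fanoutFn_mem_FP hg id_mem_FP)

/-- Value of `fixF`. [folklore] -/
theorem fixF_apply (g : List Bool → List Bool) (u : List Bool) : fixF g u = [decide (g u = u)] := by
  simp [fixF, eqPairFn_boolPair]

/-- `fixF g` is one-bit. [folklore] -/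
theorem oneBit_fixF (g : List Bool → List Bool) : OneBit (fixF g) := fun u => ⟨_, fixF_apply g u⟩

/-- **Header test** on a matrix code `a = ⟨nc, ⟨hm, ents⟩⟩`: `[encodeNat |hm| = encodeNat ⟦nc⟧²]`.
[folklore] -/
def hdrT : List Bool → List Bool :=
  eqPairFn ∘ fanoutFn (lenBinF ∘ fstF ∘ sndF) (prodFn ∘ fanoutFn fstF fstF)

/-- `hdrT ∈ FP`. [cite: AroraBarakCC2009, §1.3] -/
theorem hdrT_mem_FP : hdrT ∈ FP :=
  comp_mem_FP eqPairFn_mem_FP (fanoutFn_mem_FP (comp_mem_FP lenBinF_mem_FP (comp_mem_FP fstF_mem_FP sndF_mem_FP))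
    (comp_mem_FP prodFn_mem_FP (fanoutFn_mem_FP fstF_mem_FP fstF_mem_FP)))

/-- Value of `hdrT`. [folklore] -/
theorem hdrT_apply (a : List Bool) :
    hdrT a = [decide ((fstF (sndF a)).length = bitsToNat (fstF a) * bitsToNat (fstF a))] := by
  simp only [hdrT, Function.comp_apply, fanoutFn_apply, eqPairFn_boolPair, lenBinF_apply, prodFn_boolPair]
  congr 1
  apply Bool.decide_congr
  exact ⟨fun h => by simpa using congrArg decodeNat h, fun h => by rw [h]⟩

/-- `hdrT` is one-bit. [folklore] -/
theorem oneBit_hdrT : OneBit hdrT := fun a => ⟨_, hdrT_apply a⟩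

/-- **The matrix-code test** on `a`: well paired, canonical numeral in front, canonical integer-list
code behind, header of length `n²`. [cite: AroraBarak2009, §0.1] -/
def matT : List Bool → List Bool :=
  andFn wpF (andFn (fixF canonF ∘ fstF) (andFn (fixF (canonListFn canonIntFn) ∘ sndF) hdrT))

/-- `matT ∈ FP`. [cite: AroraBarakCC2009, §1.3] -/
theorem matT_mem_FP : matT ∈ FP :=
  andFn_mem_FP wpF_mem_FP (andFn_mem_FP (comp_mem_FP (fixF_mem_FP canonF_mem_FP) fstF_mem_FP)
    (andFn_mem_FP (comp_mem_FP (fixF_mem_FP (canonListFn_mem_FP canonIntFn_mem_FP length_canonIntFn_le)) sndF_mem_FP)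
      hdrT_mem_FP))

/-- The proposition decided by `matT`. [folklore] -/
def MatOK (a : List Bool) : Prop :=
  boolPair (fstF a) (sndF a) = a ∧ canonF (fstF a) = fstF a ∧ canonListFn canonIntFn (sndF a) = sndF a ∧
    (fstF (sndF a)).length = bitsToNat (fstF a) * bitsToNat (fstF a)

/-- `MatOK` is decidable. [folklore] -/
instance MatOK.decidable : DecidablePred MatOK := fun a => by
  unfold MatOK; infer_instance

/-- Value of `matT`. [folklore] -/
theorem matT_apply (a : List Bool) : matT a = [decide (MatOK a)] := by
  have h : matT a = [decide (boolPair (fstF a) (sndF a) = a ∧ (canonF (fstF a) = fstF a ∧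
      (canonListFn canonIntFn (sndF a) = sndF a ∧ (fstF (sndF a)).length = bitsToNat (fstF a) * bitsToNat (fstF a))))] :=
    andFn_decide (wpF_apply a) (andFn_decide (by rw [Function.comp_apply, fixF_apply])
      (andFn_decide (by rw [Function.comp_apply, fixF_apply]) (hdrT_apply a)))
  rw [h]
  exact congrArg (fun b => [b]) (Bool.decide_congr Iff.rfl)

/-- `matT` is one-bit. [folklore] -/
theorem oneBit_matT : OneBit matT := fun a => ⟨_, matT_apply a⟩

/-- **The instance-code test**: well paired, a matrix code in front, a canonical integer code
behind. [cite: AroraBarak2009, §0.1] -/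
def instCodeFn : List Bool → List Bool :=
  andFn wpF (andFn (matT ∘ fstF) (fixF canonIntFn ∘ sndF))

/-- **`instCodeFn ∈ FP`.** [cite: AroraBarakCC2009, §1.3] -/
theorem instCodeFn_mem_FP : instCodeFn ∈ FP :=
  andFn_mem_FP wpF_mem_FP (andFn_mem_FP (comp_mem_FP matT_mem_FP fstF_mem_FP)
    (comp_mem_FP (fixF_mem_FP canonIntFn_mem_FP) sndF_mem_FP))

/-- The proposition decided by `instCodeFn`. [folklore] -/
def InstOK (x : List Bool) : Prop :=
  boolPair (fstF x) (sndF x) = x ∧ MatOK (fstF x) ∧ canonIntFn (sndF x) = sndF x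

/-- `InstOK` is decidable. [folklore] -/
instance InstOK.decidable : DecidablePred InstOK := fun x => by
  unfold InstOK; infer_instance

/-- Value of `instCodeFn`. [folklore] -/
theorem instCodeFn_apply (x : List Bool) : instCodeFn x = [decide (InstOK x)] := by
  have h : instCodeFn x = [decide (boolPair (fstF x) (sndF x) = x ∧ (MatOK (fstF x) ∧ canonIntFn (sndF x) = sndF x))] :=
    andFn_decide (wpF_apply x) (andFn_decide (by rw [Function.comp_apply, matT_apply])
      (by rw [Function.comp_apply, fixF_apply]))
  rw [h]
  exact congrArg (fun b => [b]) (Bool.decide_congr Iff.rfl)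

/-- `instCodeFn` is one-bit. [folklore] -/
theorem oneBit_instCodeFn : OneBit instCodeFn := fun x => ⟨_, instCodeFn_apply x⟩

/-! ### The instance-code test recognises exactly the codes of instances -/

/-- A canonical integer code re-encodes to itself. [folklore] -/
theorem canonIntFn_encode (K : ℤ) : canonIntFn (encodingIntBool.encode K) = encodingIntBool.encode K := by
  rw [canonIntFn_eq]
  have h := decode_int (encodingIntBool.encode K)
  rw [encodingIntBool.decode_encode] at h
  rw [← Option.some.inj h]

/-- A canonical integer-list code re-encodes to itself. [folklore] -/
theorem canonListFn_encode (l : List ℤ) :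
    canonListFn canonIntFn (encodingIntBool.listBool.encode l) = encodingIntBool.listBool.encode l := by
  obtain ⟨hdec, hcan⟩ := canonListFn_eq encodingIntBool decInt decode_int canonIntFn_eq (encodingIntBool.listBool.encode l)
  rw [encodingIntBool.listBool.decode_encode] at hdec
  rw [hcan, ← Option.some.inj hdec]

/-- The matrix built from a flat list of `n²` integers, row-major. [folklore] -/
def matrixOfList (n : ℕ) (l : List ℤ) : Matrix (Fin n) (Fin n) ℤ := fun i j => l.getD (i * n + j) 0

/-- The row-major flattening of `matrixOfList n l` is `l` (for `|l| = n²`). [folklore] -/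
theorem ofFn_matrixOfList {n : ℕ} {l : List ℤ} (hl : l.length = n * n) :
    (List.ofFn fun m : Fin (n * n) => matrixOfList n l m.divNat m.modNat) = l := by
  apply List.ext_getElem (by simp [hl])
  intro k h₁ h₂
  simp only [List.getElem_ofFn, matrixOfList, Fin.coe_divNat, Fin.coe_modNat]
  rw [Nat.div_add_mod' k n, List.getD_eq_getElem _ _ h₂]

/-- **The test accepts the code of every instance.** [folklore] -/
theorem instOK_encode (n : ℕ) (J : Matrix (Fin n) (Fin n) ℤ) (K : ℤ) : InstOK (instEnc.encode (⟨n, J⟩, K)) := by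
  have hM : (Literature.Algebra.EuclideanLattices.encodingIntMatrixFin n).encode J =
      encodingIntBool.listBool.encode (List.ofFn fun m : Fin (n * n) => J m.divNat m.modNat) := rfl
  have hx : instEnc.encode (⟨n, J⟩, K) =
      boolPair (boolPair (encodeNat n) ((Literature.Algebra.EuclideanLattices.encodingIntMatrixFin n).encode J))
        (encodingIntBool.encode K) := rfl
  refine ⟨by rw [hx]; simp, ⟨?_, ?_, ?_, ?_⟩, ?_⟩
  · rw [hx]; simp
  · rw [hx]; simp [canonF_eq_encodeNat_decodeNat]
  · rw [hx, fstF_boolPair, sndF_boolPair, hM, canonListFn_encode]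
  · rw [hx, fstF_boolPair, sndF_boolPair, fstF_boolPair, hM, CNFIsing.listBool_encode_eq_boolPair, fstF_boolPair,
      bitsToNat_encodeNat]
    simp
  · rw [hx, sndF_boolPair, canonIntFn_encode]

/-- **A string passing the test is the code of an instance.** [folklore] -/
theorem exists_eq_encode_of_instOK {x : List Bool} (h : InstOK x) :
    ∃ (n : ℕ) (J : Matrix (Fin n) (Fin n) ℤ) (K : ℤ), x = instEnc.encode (⟨n, J⟩, K) := by
  obtain ⟨hwp, ⟨hawp, hnc, hM, hhdr⟩, hK⟩ := h
  set a := fstF x with ha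
  set M := sndF a with hMdef
  -- the dimension
  set n := decodeNat (fstF a) with hn
  have hnc' : fstF a = encodeNat n := by rw [← hnc, canonF_eq_encodeNat_decodeNat]
  have hval : bitsToNat (fstF a) = n := by rw [hnc', bitsToNat_encodeNat]
  -- the entries
  obtain ⟨-, hcan⟩ := canonListFn_eq encodingIntBool decInt decode_int canonIntFn_eq M
  set l := NegCNF.decList decInt (boolUnpair M).1.length (boolUnpair M).2 with hl
  have hMl : M = encodingIntBool.listBool.encode l := by rw [← hcan, hM]
  have hlen : l.length = n * n := by
    rw [hl, NegCNF.length_decList, ← hval, ← hhdr]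
    rfl
  -- the threshold
  set K := decInt (sndF x)
  have hK' : sndF x = encodingIntBool.encode K := by rw [← hK, canonIntFn_eq]
  refine ⟨n, matrixOfList n l, K, ?_⟩
  have hJ : (Literature.Algebra.EuclideanLattices.encodingIntMatrixFin n).encode (matrixOfList n l) =
      encodingIntBool.listBool.encode l := by
    change encodingIntBool.listBool.encode (List.ofFn fun m : Fin (n * n) => matrixOfList n l m.divNat m.modNat) = _
    rw [ofFn_matrixOfList hlen]
  calc x = boolPair a (sndF x) := by rw [ha, hwp]
    _ = boolPair (boolPair (fstF a) M) (sndF x) := by rw [hMdef, hawp]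
    _ = instEnc.encode (⟨n, matrixOfList n l⟩, K) := by
        rw [hnc', hMl, hK', ← hJ]; rfl

/-- **`instCodeFn x = [1]` iff `x` is the code of an instance.** [cite: AroraBarak2009, §0.1] -/
theorem instCodeFn_eq_true_iff (x : List Bool) :
    instCodeFn x = [true] ↔ ∃ (n : ℕ) (J : Matrix (Fin n) (Fin n) ℤ) (K : ℤ), x = instEnc.encode (⟨n, J⟩, K) := by
  rw [instCodeFn_apply]
  simp only [List.cons.injEq, and_true, decide_eq_true_eq]
  exact ⟨exists_eq_encode_of_instOK, fun ⟨n, J, K, hx⟩ => hx ▸ instOK_encode n J K⟩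

/-! ### The unit-coupling test -/

/-- The item test: the second field is the code of `0`, `1` or `-1`. [folklore] -/
def unitEntryT : List Bool → List Bool :=
  orFn (eqPairFn ∘ fanoutFn sndF fun _ => encodingIntBool.encode 0)
    (orFn (eqPairFn ∘ fanoutFn sndF fun _ => encodingIntBool.encode 1)
      (eqPairFn ∘ fanoutFn sndF fun _ => encodingIntBool.encode (-1)))

/-- `unitEntryT ∈ FP`. [cite: AroraBarakCC2009, §1.3] -/
theorem unitEntryT_mem_FP : unitEntryT ∈ FP :=
  iteFn_mem_FP (comp_mem_FP eqPairFn_mem_FP (fanoutFn_mem_FP sndF_mem_FP (const_mem_FP _))) (const_mem_FP _)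
    (iteFn_mem_FP (comp_mem_FP eqPairFn_mem_FP (fanoutFn_mem_FP sndF_mem_FP (const_mem_FP _))) (const_mem_FP _)
      (comp_mem_FP eqPairFn_mem_FP (fanoutFn_mem_FP sndF_mem_FP (const_mem_FP _))))

/-- Value of `unitEntryT`. [folklore] -/
theorem unitEntryT_apply (w : List Bool) :
    unitEntryT w = [decide (sndF w = encodingIntBool.encode 0 ∨ sndF w = encodingIntBool.encode 1 ∨
      sndF w = encodingIntBool.encode (-1))] := by
  have h : ∀ v : ℤ, (eqPairFn ∘ fanoutFn sndF fun _ => encodingIntBool.encode v) w =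
      [decide (sndF w = encodingIntBool.encode v)] := fun v => by
    simp [eqPairFn_boolPair]
  unfold unitEntryT
  rw [orFn_apply (h 0) (orFn_apply (h 1) (h (-1)))]
  simp [Bool.decide_or]

/-- `unitEntryT` is one-bit. [folklore] -/
theorem oneBit_unitEntryT : OneBit unitEntryT := fun w => ⟨_, unitEntryT_apply w⟩

/-- The body of the entry list of an instance code `x = ⟨⟨nc, ⟨hm, ents⟩⟩, kc⟩`. [folklore] -/
def entsFn : List Bool → List Bool := sndF ∘ sndF ∘ fstF

/-- `entsFn ∈ FP`. [folklore] -/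
theorem entsFn_mem_FP : entsFn ∈ FP := comp_mem_FP sndF_mem_FP (comp_mem_FP sndF_mem_FP fstF_mem_FP)

/-- `entsFn` on the code of an instance. [folklore] -/
theorem entsFn_encode (n : ℕ) (J : Matrix (Fin n) (Fin n) ℤ) (K : ℤ) :
    entsFn (instEnc.encode (⟨n, J⟩, K)) = body (entryList n J) := by
  rw [instEnc_encode_eq]; simp [entsFn]

/-- **The unit-coupling test**: every entry code is the code of `0`, `1` or `-1`. [cite: TroyerWiese2005, Letter p. 4] -/
def unitCouplingFn : List Bool → List Bool := allFn unitEntryT ∘ fanoutFn (fun _ => []) entsFn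

/-- `unitCouplingFn ∈ FP`. [cite: AroraBarakCC2009, §1.3] -/
theorem unitCouplingFn_mem_FP : unitCouplingFn ∈ FP :=
  comp_mem_FP (allFn_mem_FP unitEntryT_mem_FP oneBit_unitEntryT) (fanoutFn_mem_FP (const_mem_FP _) entsFn_mem_FP)

/-- `unitCouplingFn` is one-bit. [folklore] -/
theorem oneBit_unitCouplingFn : OneBit unitCouplingFn := fun x => by
  rw [unitCouplingFn, Function.comp_apply, allFn_apply oneBit_unitEntryT]
  exact ⟨_, rfl⟩

/-- The tree's two nested-pair list codings agree: `body = encList`. [folklore] -/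
theorem body_eq_encList : ∀ l : List (List Bool), body l = encList l
  | [] => rfl
  | a :: l => by rw [body_cons, encList_cons, body_eq_encList l]

/-- `IsUnitCoupling` is decidable (finitely many entries). [folklore] -/
instance IsUnitCoupling.decidable {n : ℕ} (J : Matrix (Fin n) (Fin n) ℤ) : Decidable (IsUnitCoupling J) := by
  unfold IsUnitCoupling; infer_instance

/-- **Value of the unit-coupling test on the code of an instance.** [folklore] -/
theorem unitCouplingFn_encode (n : ℕ) (J : Matrix (Fin n) (Fin n) ℤ) (K : ℤ) :
    unitCouplingFn (instEnc.encode (⟨n, J⟩, K)) = [decide (IsUnitCoupling J)] := by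
  rw [unitCouplingFn, Function.comp_apply, fanoutFn_apply, entsFn_encode, allFn_boolPair oneBit_unitEntryT, body_eq_encList,
    decNil_encList]
  congr 1
  apply Bool.decide_congr
  simp only [unitEntryT_apply, sndF_boolPair, List.cons.injEq, and_true, decide_eq_true_eq]
  have hinj := encodingIntBool.encode_injective
  constructor
  · intro h i j
    have hm : encodingIntBool.encode (J i j) ∈ entryList n J := by
      have h1 : ((i : ℕ) + 1) * n ≤ n * n := Nat.mul_le_mul_right n (Nat.succ_le_of_lt i.isLt)
      have hlt : (i : ℕ) * n + j < n * n := by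
        rw [Nat.succ_mul] at h1
        have := j.isLt
        omega
      have hi : ((i : ℕ) * n + j) / n = i := by
        rw [Nat.add_comm, Nat.add_mul_div_right _ _ (Fin.pos i), Nat.div_eq_of_lt j.isLt, Nat.zero_add]
      have hj : ((i : ℕ) * n + j) % n = j := by
        rw [Nat.add_comm, Nat.add_mul_mod_self_right, Nat.mod_eq_of_lt j.isLt]
      have hget := getD_entryList J hlt
      simp only [hi, hj, Fin.eta] at hget
      rw [← hget, List.getD_eq_getElem _ _ (by simpa using hlt)]
      exact List.getElem_mem _
    rcases h _ hm with h0 | h1 | h2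
    · exact Or.inl (hinj h0)
    · exact Or.inr (Or.inl (hinj h1))
    · exact Or.inr (Or.inr (hinj h2))
  · intro h a ha
    simp only [entryList, List.mem_ofFn] at ha
    obtain ⟨m, rfl⟩ := ha
    rcases h m.divNat m.modNat with h0 | h1 | h2
    · exact Or.inl (by rw [h0])
    · exact Or.inr (Or.inl (by rw [h1]))
    · exact Or.inr (Or.inr (by rw [h2]))

/-! ### The `P` language of codes of unit-coupling instances -/

/-- The test "code of a unit-coupling instance". [folklore] -/
def goodInstFn : List Bool → List Bool := andFn instCodeFn unitCouplingFn

/-- `goodInstFn ∈ FP`. [cite: AroraBarakCC2009, §1.3] -/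
theorem goodInstFn_mem_FP : goodInstFn ∈ FP := andFn_mem_FP instCodeFn_mem_FP unitCouplingFn_mem_FP

/-- `goodInstFn` is one-bit. [folklore] -/
theorem oneBit_goodInstFn : OneBit goodInstFn := oneBit_andFn oneBit_instCodeFn oneBit_unitCouplingFn

/-- **The language of codes of unit-coupling instances.** [cite: TroyerWiese2005, Letter p. 4] -/
def goodInstLang : Language Bool := {x | goodInstFn x = [true]}

/-- A language cut out by a one-bit `FP` test is in `P`. [cite: AroraBarakCC2009, Def. 1.13] -/
theorem mem_P_of_oneBit {g : List Bool → List Bool} (hg : g ∈ FP) (h1 : OneBit g) :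
    ({w | g w = [true]} : Language Bool) ∈ Classes.P :=
  mem_P_of_mem_FP hg _ fun w =>
    ⟨fun h => h, fun h => by
      obtain ⟨b, hb⟩ := h1 w
      cases b
      · exact hb
      · exact absurd hb h⟩

/-- **`goodInstLang ∈ P`.** [cite: AroraBarakCC2009, Def. 1.13 and §1.3] -/
theorem goodInstLang_mem_P : goodInstLang ∈ Classes.P := mem_P_of_oneBit goodInstFn_mem_FP oneBit_goodInstFn

/-- **Membership in `goodInstLang`**: exactly the codes of unit-coupling instances. [folklore] -/
theorem mem_goodInstLang_iff (x : List Bool) :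
    x ∈ goodInstLang ↔ ∃ (n : ℕ) (J : Matrix (Fin n) (Fin n) ℤ) (K : ℤ), x = instEnc.encode (⟨n, J⟩, K) ∧ IsUnitCoupling J := by
  change andFn instCodeFn unitCouplingFn x = [true] ↔ _
  obtain ⟨b, hb⟩ := oneBit_unitCouplingFn x
  rw [andFn_apply (instCodeFn_apply x) hb]
  simp only [List.cons.injEq, and_true, Bool.and_eq_true, decide_eq_true_eq]
  constructor
  · rintro ⟨hx, hbt⟩
    obtain ⟨n, J, K, rfl⟩ := exists_eq_encode_of_instOK hx
    rw [unitCouplingFn_encode] at hb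
    refine ⟨n, J, K, rfl, ?_⟩
    subst hbt
    simpa using hb
  · rintro ⟨n, J, K, rfl, hu⟩
    rw [unitCouplingFn_encode] at hb
    refine ⟨instOK_encode n J K, ?_⟩
    rw [← Option.some.inj (congrArg List.head? hb)]
    simpa using hu

/-! ### The energy verifier: projections of `w = ⟨x, y⟩`, `x = ⟨⟨nc, ⟨hm, ents⟩⟩, kc⟩` -/

/-- The binary dimension header `nc`. [folklore] -/
def ivNcFn : List Bool → List Bool := fstF ∘ fstF ∘ fstF
/-- The unary entry-count header `hm` (`1^{n²}` on a code). [folklore] -/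
def ivHmFn : List Bool → List Bool := fstF ∘ sndF ∘ fstF ∘ fstF
/-- The body of the entry list. [folklore] -/
def ivEntsFn : List Bool → List Bool := entsFn ∘ fstF
/-- The threshold code `kc`. [folklore] -/
def ivKcFn : List Bool → List Bool := sndF ∘ fstF
/-- The unary dimension `1ⁿ` (binary header converted against the ruler `w`). [folklore] -/
def ivOnesFn : List Bool → List Bool := binToUnaryFn ∘ fanoutFn id ivNcFn

/-- `ivNcFn ∈ FP`. [folklore] -/
theorem ivNcFn_mem_FP : ivNcFn ∈ FP := comp_mem_FP fstF_mem_FP (comp_mem_FP fstF_mem_FP fstF_mem_FP)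
/-- `ivHmFn ∈ FP`. [folklore] -/
theorem ivHmFn_mem_FP : ivHmFn ∈ FP :=
  comp_mem_FP fstF_mem_FP (comp_mem_FP sndF_mem_FP (comp_mem_FP fstF_mem_FP fstF_mem_FP))
/-- `ivEntsFn ∈ FP`. [folklore] -/
theorem ivEntsFn_mem_FP : ivEntsFn ∈ FP := comp_mem_FP entsFn_mem_FP fstF_mem_FP
/-- `ivKcFn ∈ FP`. [folklore] -/
theorem ivKcFn_mem_FP : ivKcFn ∈ FP := comp_mem_FP sndF_mem_FP fstF_mem_FP
/-- `ivOnesFn ∈ FP`. [folklore] -/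
theorem ivOnesFn_mem_FP : ivOnesFn ∈ FP := comp_mem_FP binToUnaryFn_mem_FP (fanoutFn_mem_FP id_mem_FP ivNcFn_mem_FP)

/-! ### The piece function of the fold: the term of the flat index `t` on `⟨w, 1ᵗ⟩` -/

/-- `⟨1^{t / n}, 1^{t % n}⟩`: the row and column of the flat index. [folklore] -/
def ivIJFn : List Bool → List Bool := divModFn ∘ fanoutFn (ivOnesFn ∘ fstF) sndF
/-- `1ⁱ`, `i = t / n`. [folklore] -/
def ivIFn : List Bool → List Bool := fstF ∘ ivIJFn
/-- `1ʲ`, `j = t % n`. [folklore] -/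
def ivJFn : List Bool → List Bool := sndF ∘ ivIJFn
/-- The entry `J_{ij}` as a difference pair (read by index `t` from the entry body). [folklore] -/
def ivEntFn : List Bool → List Bool := ofSMFn ∘ elemFn ∘ fanoutFn sndF (ivEntsFn ∘ fstF)
/-- The witness bit `[y[i]]` (default `false`). [folklore] -/
def ivBitIFn : List Bool → List Bool := headBitFn ∘ dropFn ∘ fanoutFn ivIFn (sndF ∘ fstF)
/-- The witness bit `[y[j]]` (default `false`). [folklore] -/
def ivBitJFn : List Bool → List Bool := headBitFn ∘ dropFn ∘ fanoutFn ivJFn (sndF ∘ fstF)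
/-- The test `[i < j]`. [folklore] -/
def ivLtT : List Bool → List Bool := ltLenF ∘ ivIJFn
/-- The test `[y[i] = y[j]]` (equal spins). [folklore] -/
def ivEqT : List Bool → List Bool := eqPairFn ∘ fanoutFn ivBitIFn ivBitJFn

/-- **The piece function**: the term `-J_{ij} s_i s_j` of the energy for `i < j` (the entry negated
when the spins agree), `0` otherwise, as a difference pair. [cite: TroyerWiese2005, Letter p. 4 (`H = -Σ J_{jk} σ_j σ_k`)] -/
def ivPieceFn : List Bool → List Bool :=
  iteFn ivLtT (iteFn ivEqT (zswapF ∘ ivEntFn) ivEntFn) fun _ => boolPair [] []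

/-- `ivIJFn ∈ FP`. [folklore] -/
theorem ivIJFn_mem_FP : ivIJFn ∈ FP :=
  comp_mem_FP divModFn_mem_FP (fanoutFn_mem_FP (comp_mem_FP ivOnesFn_mem_FP fstF_mem_FP) sndF_mem_FP)
/-- `ivIFn ∈ FP`. [folklore] -/
theorem ivIFn_mem_FP : ivIFn ∈ FP := comp_mem_FP fstF_mem_FP ivIJFn_mem_FP
/-- `ivJFn ∈ FP`. [folklore] -/
theorem ivJFn_mem_FP : ivJFn ∈ FP := comp_mem_FP sndF_mem_FP ivIJFn_mem_FP
/-- `ivEntFn ∈ FP`. [folklore] -/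
theorem ivEntFn_mem_FP : ivEntFn ∈ FP :=
  comp_mem_FP ofSMFn_mem_FP (comp_mem_FP elemFn_mem_FP (fanoutFn_mem_FP sndF_mem_FP (comp_mem_FP ivEntsFn_mem_FP fstF_mem_FP)))
/-- `ivBitIFn ∈ FP`. [folklore] -/
theorem ivBitIFn_mem_FP : ivBitIFn ∈ FP :=
  comp_mem_FP headBitFn_mem_FP (comp_mem_FP dropFn_mem_FP (fanoutFn_mem_FP ivIFn_mem_FP (comp_mem_FP sndF_mem_FP fstF_mem_FP)))
/-- `ivBitJFn ∈ FP`. [folklore] -/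
theorem ivBitJFn_mem_FP : ivBitJFn ∈ FP :=
  comp_mem_FP headBitFn_mem_FP (comp_mem_FP dropFn_mem_FP (fanoutFn_mem_FP ivJFn_mem_FP (comp_mem_FP sndF_mem_FP fstF_mem_FP)))
/-- `ivLtT ∈ FP`. [folklore] -/
theorem ivLtT_mem_FP : ivLtT ∈ FP := comp_mem_FP ltLenF_mem_FP ivIJFn_mem_FP
/-- `ivEqT ∈ FP`. [folklore] -/
theorem ivEqT_mem_FP : ivEqT ∈ FP := comp_mem_FP eqPairFn_mem_FP (fanoutFn_mem_FP ivBitIFn_mem_FP ivBitJFn_mem_FP)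
/-- **`ivPieceFn ∈ FP`.** [cite: AroraBarakCC2009, §1.3] -/
theorem ivPieceFn_mem_FP : ivPieceFn ∈ FP :=
  iteFn_mem_FP ivLtT_mem_FP (iteFn_mem_FP ivEqT_mem_FP (comp_mem_FP zswapF_mem_FP ivEntFn_mem_FP) ivEntFn_mem_FP) (const_mem_FP _)

/-- `ivLtT` is one-bit. [folklore] -/
theorem oneBit_ivLtT : OneBit ivLtT := oneBit_ltLenF.comp _
/-- `ivEqT` is one-bit. [folklore] -/
theorem oneBit_ivEqT : OneBit ivEqT := CNFIsing.oneBit_eqPairFn.comp _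

/-! ### The fold and the verifier -/

/-- The record handed to the fold: `⟨w, ⟨encodeNat |hm|, ⟨1⁰, ⟨ε, ε⟩⟩⟩⟩` (countdown `n²`, index `0`,
accumulator the difference pair `0`). [folklore] -/
def ivRecFn : List Bool → List Bool :=
  fanoutFn id (fanoutFn (lenBinF ∘ ivHmFn) (fanoutFn (fun _ => []) fun _ => boolPair [] []))

/-- The accumulated energy `E_J(σ_y)` as a difference pair: `n²` rounds of the fold of `iaddFn` over
the (clipped) pieces. [cite: AroraBarakCC2009, §1.3 (bounded loops)] -/
def ivAccFn : List Bool → List Bool := sndPow 2 ∘ foldLoop iaddFn (clipF 6 ivPieceFn) X ∘ ivRecFn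

/-- **The verifier**: accept `⟨x, y⟩` iff `E_J(σ_y) ≤ K` for the instance `(⟨n, J⟩, K)` coded by `x`
and the configuration `σ_y` read off `y`. [cite: TroyerWiese2005, Letter p. 4] -/
def isingVerifFn : List Bool → List Bool := zleF ∘ fanoutFn ivAccFn (ofSMFn ∘ ivKcFn)

/-- `ivRecFn ∈ FP`. [folklore] -/
theorem ivRecFn_mem_FP : ivRecFn ∈ FP :=
  fanoutFn_mem_FP id_mem_FP (fanoutFn_mem_FP (comp_mem_FP lenBinF_mem_FP ivHmFn_mem_FP)
    (fanoutFn_mem_FP (const_mem_FP _) (const_mem_FP _)))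

/-- `iaddFn` reads its argument through the pair decoder. [folklore] -/
theorem iaddFn_eq_boolPair (w : List Bool) : iaddFn w = iaddFn (boolPair (fstF w) (sndF w)) := by
  simp only [iaddFn, fanoutFn_apply, Function.comp_apply, fstF_boolPair, sndF_boolPair]

/-- Growth of `iaddFn`: additive plus five symbols, on every input. [folklore] -/
theorem length_iaddFn_le (w : List Bool) : (iaddFn w).length ≤ (fstF w).length + (sndF w).length + 5 := by
  rw [iaddFn_eq_boolPair]; exact length_iaddFn_boolPair_le _ _

/-- `ivAccFn ∈ FP`. [cite: AroraBarakCC2009, §1.3 (bounded loops)] -/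
theorem ivAccFn_mem_FP : ivAccFn ∈ FP :=
  comp_mem_FP (sndPow_mem_FP 2) (comp_mem_FP (foldLoop_clipF_mem_FP 6 iaddFn_mem_FP length_iaddFn_le ivPieceFn_mem_FP X)
    ivRecFn_mem_FP)

/-- **The verifier is polynomial-time**: `isingVerifFn ∈ FP`. [cite: AroraBarakCC2009, §1.3] -/
theorem isingVerifFn_mem_FP : isingVerifFn ∈ FP :=
  comp_mem_FP zleF_mem_FP (fanoutFn_mem_FP ivAccFn_mem_FP (comp_mem_FP ofSMFn_mem_FP ivKcFn_mem_FP))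

/-- The verifier answers one bit on every input. [folklore] -/
theorem oneBit_isingVerifFn : OneBit isingVerifFn := oneBit_zleF.comp _

/-- The `P` language of accepted pairs `⟨x, y⟩`. [cite: AroraBarakCC2009, Def. 2.1] -/
def isingVerifLang : Language Bool := {w | isingVerifFn w = [true]}

/-- **`isingVerifLang ∈ P`.** [cite: AroraBarakCC2009, Def. 1.13 and §1.3] -/
theorem isingVerifLang_mem_P : isingVerifLang ∈ Classes.P := mem_P_of_oneBit isingVerifFn_mem_FP oneBit_isingVerifFn

/-! ### The value of the verifier on the code of an instance -/

/-- The spin configuration read off an arbitrary witness string: `σ_y i = y[i]`, default `false`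
beyond the end of `y`. [folklore] -/
def spinOf (n : ℕ) (y : List Bool) : Fin n → Bool := fun i => y.getD i false

/-- The term of the pair `(i, j)`: `-J_{ij} s_i s_j` for `i < j`, else `0`. [folklore] -/
def termVal {n : ℕ} (J : Matrix (Fin n) (Fin n) ℤ) (y : List Bool) (i j : Fin n) : ℤ :=
  if i < j then (if y.getD i false = y.getD j false then -J i j else J i j) else 0

/-- The term agrees with the summand of `isingEnergy` (with its sign). [folklore] -/
theorem termVal_eq {n : ℕ} (J : Matrix (Fin n) (Fin n) ℤ) (y : List Bool) (i j : Fin n) :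
    termVal J y i j = -(if i < j then J i j * spinSign (spinOf n y) i * spinSign (spinOf n y) j else 0) := by
  unfold termVal spinSign spinOf
  by_cases hij : i < j
  · simp only [hij, if_true]
    cases y.getD i false <;> cases y.getD j false <;> simp
  · simp [hij]

/-- **The energy as a double sum of terms.** [cite: TroyerWiese2005, Letter p. 4] -/
theorem isingEnergy_eq_sum_termVal {n : ℕ} (J : Matrix (Fin n) (Fin n) ℤ) (y : List Bool) :
    isingEnergy J (spinOf n y) = ∑ i, ∑ j, termVal J y i j := by
  simp only [isingEnergy, termVal_eq, Finset.sum_neg_distrib]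

/-- A double sum over `Fin n × Fin n` as a sum over the flat index `t = i n + j < n²`. [folklore] -/
theorem sum_range_mul_eq {n : ℕ} (g : Fin n → Fin n → ℤ) (f : ℕ → ℤ)
    (hf : ∀ i j : Fin n, f (i * n + j) = g i j) : ∑ t ∈ Finset.range (n * n), f t = ∑ i, ∑ j, g i j := by
  rw [Finset.sum_range, ← Equiv.sum_comp finProdFinEquiv, Fintype.sum_prod_type]
  refine Finset.sum_congr rfl fun i _ => Finset.sum_congr rfl fun j _ => ?_
  rw [finProdFinEquiv_apply_val, ← hf i j]
  congr 1
  ring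

/-- `ival` of the fold of `iaddFn` is the sum of the `ival`s of the pieces. [folklore] -/
theorem ival_foldAcc_iaddFn (f : List Bool → List Bool) (x : List Bool) : ∀ (k i : ℕ) (acc : List Bool),
    ival (foldAcc iaddFn f x i k acc) = ival acc + ∑ j ∈ Finset.range k, ival (f (boolPair x (ones (i + j))))
  | 0, i, acc => by simp
  | k + 1, i, acc => by
    rw [foldAcc_succ', ival_iaddFn_boolPair, ival_foldAcc_iaddFn f x k i acc, Finset.sum_range_succ, add_assoc]

/-- Length of `zswapF`. [folklore] -/
theorem length_zswapF_le (u : List Bool) : (zswapF u).length ≤ 2 * u.length + 2 := by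
  have h := length_fstF_sndF_le u
  simp only [zswapF, fanoutFn_apply, length_boolPair]
  omega

section Decode

variable (n : ℕ) (J : Matrix (Fin n) (Fin n) ℤ) (K : ℤ) (y : List Bool)

/-- The projections on the code of an instance paired with any string. [folklore] -/
theorem proj_encode :
    ivNcFn (boolPair (instEnc.encode (⟨n, J⟩, K)) y) = encodeNat n ∧
      ivHmFn (boolPair (instEnc.encode (⟨n, J⟩, K)) y) = ones (n * n) ∧
        ivEntsFn (boolPair (instEnc.encode (⟨n, J⟩, K)) y) = body (entryList n J) ∧
          ivKcFn (boolPair (instEnc.encode (⟨n, J⟩, K)) y) = encodingIntBool.encode K := by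
  rw [instEnc_encode_eq]
  simp [ivNcFn, ivHmFn, ivEntsFn, entsFn, ivKcFn]

/-- `n ≤ |w|` for `w = ⟨code (⟨n, J⟩, K), y⟩`. [folklore] -/
theorem n_le_length_pair : n ≤ (boolPair (instEnc.encode (⟨n, J⟩, K)) y).length := by
  have h1 := le_length_instEnc_encode n J K
  rw [length_boolPair]
  rcases Nat.eq_zero_or_pos n with h0 | hpos
  · omega
  · nlinarith

/-- `n² ≤ |w|`. [folklore] -/
theorem nsq_le_length_pair : n * n ≤ (boolPair (instEnc.encode (⟨n, J⟩, K)) y).length := by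
  have h1 := le_length_instEnc_encode n J K
  rw [length_boolPair]
  omega

/-- The unary dimension on the code of an instance. [folklore] -/
theorem ivOnesFn_encode : ivOnesFn (boolPair (instEnc.encode (⟨n, J⟩, K)) y) = ones n := by
  rw [ivOnesFn, Function.comp_apply, fanoutFn_apply, (proj_encode n J K y).1, id, binToUnaryFn_boolPair,
    bitsToNat_encodeNat, min_eq_left (n_le_length_pair n J K y)]

variable {n}

/-- Row and column of a flat index below `n²`. [folklore] -/
theorem div_lt_of_lt_mul {t : ℕ} (ht : t < n * n) : t / n < n :=
  Nat.div_lt_of_lt_mul (by rwa [Nat.mul_comm])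

/-- `n` is positive if some flat index is below `n²`. [folklore] -/
theorem pos_of_lt_mul {t : ℕ} (ht : t < n * n) : 0 < n :=
  Nat.pos_of_ne_zero fun h => by simp [h] at ht

/-- **The value of the piece function** on `⟨w, 1ᵗ⟩`, `t < n²`: the term of `(t / n, t % n)`. [folklore] -/
theorem ival_ivPieceFn_encode {t : ℕ} (ht : t < n * n) :
    ival (ivPieceFn (boolPair (boolPair (instEnc.encode (⟨n, J⟩, K)) y) (ones t))) =
      termVal J y ⟨t / n, div_lt_of_lt_mul ht⟩ ⟨t % n, Nat.mod_lt _ (pos_of_lt_mul ht)⟩ := by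
  set w := boolPair (instEnc.encode (⟨n, J⟩, K)) y with hw
  obtain ⟨-, -, hents, -⟩ := proj_encode n J K y
  have hij : ivIJFn (boolPair w (ones t)) = boolPair (ones (t / n)) (ones (t % n)) := by
    rw [ivIJFn, Function.comp_apply, fanoutFn_apply, Function.comp_apply, fstF_boolPair, sndF_boolPair, hw,
      ivOnesFn_encode, divModFn_boolPair]
  have hy : sndF (fstF (boolPair w (ones t))) = y := by rw [fstF_boolPair, hw, sndF_boolPair]
  have headD_drop : ∀ i : ℕ, (y.drop i).headD false = y.getD i false := fun i => by
    rw [List.headD_eq_head?_getD, List.head?_drop, List.getD_eq_getElem?_getD]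
  have hbi : ivBitIFn (boolPair w (ones t)) = [y.getD (t / n) false] := by
    rw [ivBitIFn, Function.comp_apply, Function.comp_apply, fanoutFn_apply, ivIFn, Function.comp_apply, hij,
      fstF_boolPair, Function.comp_apply, hy, dropFn_boolPair, headBitFn_apply, List.length_replicate, headD_drop]
  have hbj : ivBitJFn (boolPair w (ones t)) = [y.getD (t % n) false] := by
    rw [ivBitJFn, Function.comp_apply, Function.comp_apply, fanoutFn_apply, ivJFn, Function.comp_apply, hij,
      sndF_boolPair, Function.comp_apply, hy, dropFn_boolPair, headBitFn_apply, List.length_replicate, headD_drop]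
  have hlt : ivLtT (boolPair w (ones t)) = [decide (t / n < t % n)] := by
    rw [ivLtT, Function.comp_apply, hij, ltLenF_boolPair, List.length_replicate, List.length_replicate]
  have heq : ivEqT (boolPair w (ones t)) = [decide (y.getD (t / n) false = y.getD (t % n) false)] := by
    rw [ivEqT, Function.comp_apply, fanoutFn_apply, hbi, hbj, eqPairFn_boolPair]
    simp
  have hent : ival (ivEntFn (boolPair w (ones t))) = J ⟨t / n, div_lt_of_lt_mul ht⟩ ⟨t % n, Nat.mod_lt _ (pos_of_lt_mul ht)⟩ := by
    rw [ivEntFn, Function.comp_apply, Function.comp_apply, fanoutFn_apply, sndF_boolPair, Function.comp_apply,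
      fstF_boolPair, hents, elemFn_boolPair, List.length_replicate, ival_ofSMFn, elemOf_body, getD_entryList J ht,
      smval_encode]
  rw [ivPieceFn, iteFn_apply hlt]
  unfold termVal
  by_cases h1 : t / n < t % n
  · have h1' : (⟨t / n, div_lt_of_lt_mul ht⟩ : Fin n) < ⟨t % n, Nat.mod_lt _ (pos_of_lt_mul ht)⟩ := h1
    rw [decide_eq_true h1, if_pos rfl, if_pos h1', iteFn_apply heq]
    by_cases h2 : y.getD (t / n) false = y.getD (t % n) false
    · rw [decide_eq_true h2, if_pos rfl, Function.comp_apply, ival_zswapF, hent, if_pos]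
      exact h2
    · rw [decide_eq_false h2, if_neg (by decide), hent, if_neg]
      exact h2
  · have h1' : ¬ (⟨t / n, div_lt_of_lt_mul ht⟩ : Fin n) < ⟨t % n, Nat.mod_lt _ (pos_of_lt_mul ht)⟩ := h1
    rw [decide_eq_false h1, if_neg (by decide), if_neg h1']
    simp

/-- **The pieces are short** (so that clipping at `6 (|w| + 1)` symbols is invisible). [folklore] -/
theorem length_ivPieceFn_le (w u : List Bool) : (ivPieceFn (boolPair w u)).length ≤ 6 * (w.length + 1) := by
  have hent : (ivEntFn (boolPair w u)).length ≤ 2 * w.length + 2 := by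
    rw [ivEntFn, Function.comp_apply, Function.comp_apply, fanoutFn_apply, sndF_boolPair, Function.comp_apply,
      fstF_boolPair, elemFn_boolPair]
    refine (length_ofSMFn_le _).trans ?_
    have h1 := length_elemOf_le (ivEntsFn w) u.length
    have h2 : (ivEntsFn w).length ≤ w.length := by
      simp only [ivEntsFn, entsFn, Function.comp_apply]
      have a1 := length_fstF_sndF_le w
      have a2 := length_fstF_sndF_le (fstF w)
      have a3 := length_fstF_sndF_le (fstF (fstF w))
      have a4 := length_fstF_sndF_le (sndF (fstF (fstF w)))
      omega
    omega
  rw [ivPieceFn, iteFn_of_oneBit oneBit_ivLtT]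
  split_ifs
  · rw [iteFn_of_oneBit oneBit_ivEqT]
    split_ifs
    · rw [Function.comp_apply]
      have := length_zswapF_le (ivEntFn (boolPair w u))
      omega
    · omega
  · simp only [length_boolPair, List.length_nil]
    omega

/-- **The exact value of the verifier on the code of ANY instance paired with ANY string**: accept
iff `E_J(σ_y) ≤ K`. [cite: TroyerWiese2005, Letter p. 4] -/
theorem isingVerifFn_encode (n : ℕ) (J : Matrix (Fin n) (Fin n) ℤ) (K : ℤ) (y : List Bool) :
    isingVerifFn (boolPair (instEnc.encode (⟨n, J⟩, K)) y) = [decide (isingEnergy J (spinOf n y) ≤ K)] := by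
  obtain ⟨-, hhm, -, hkc⟩ := proj_encode n J K y
  have hk : n * n ≤ (X : Polynomial ℕ).eval (boolPair (instEnc.encode (⟨n, J⟩, K)) y).length := by
    rw [eval_X]; exact nsq_le_length_pair n J K y
  have hrec : ivRecFn (boolPair (instEnc.encode (⟨n, J⟩, K)) y) =
      boolPair (boolPair (instEnc.encode (⟨n, J⟩, K)) y) (boolPair (encodeNat (n * n)) (boolPair (ones 0) (boolPair [] []))) := by
    rw [ivRecFn, fanoutFn_apply, fanoutFn_apply, fanoutFn_apply, Function.comp_apply, hhm, lenBinF_apply,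
      List.length_replicate, id_eq]
    rfl
  have hacc : ivAccFn (boolPair (instEnc.encode (⟨n, J⟩, K)) y) =
      foldAcc iaddFn (clipF 6 ivPieceFn) (boolPair (instEnc.encode (⟨n, J⟩, K)) y) 0 (n * n) (boolPair [] []) := by
    rw [ivAccFn, Function.comp_apply, Function.comp_apply, hrec, foldLoop_apply _ _ hk 0, sndPow_succ_boolPair,
      sndPow_succ_boolPair, sndPow_zero_boolPair]
  have hclip : foldAcc iaddFn (clipF 6 ivPieceFn) (boolPair (instEnc.encode (⟨n, J⟩, K)) y) 0 (n * n) (boolPair [] []) =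
      foldAcc iaddFn ivPieceFn (boolPair (instEnc.encode (⟨n, J⟩, K)) y) 0 (n * n) (boolPair [] []) :=
    foldAcc_clipF fun j _ _ => length_ivPieceFn_le _ (ones j)
  have key : ∀ (i j a b : Fin n), (a : ℕ) = i → (b : ℕ) = j → termVal J y a b = termVal J y i j := by
    rintro i j a b ha hb
    obtain rfl : a = i := Fin.ext ha
    obtain rfl : b = j := Fin.ext hb
    rfl
  have hE : ival (ivAccFn (boolPair (instEnc.encode (⟨n, J⟩, K)) y)) = isingEnergy J (spinOf n y) := by
    rw [hacc, hclip, ival_foldAcc_iaddFn, ival_boolPair, isingEnergy_eq_sum_termVal]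
    simp only [bitsToNat, Nat.cast_zero, sub_zero, zero_add]
    refine sum_range_mul_eq (termVal J y) _ fun i j => ?_
    have h1 : ((i : ℕ) + 1) * n ≤ n * n := Nat.mul_le_mul_right n (Nat.succ_le_of_lt i.isLt)
    have hlt : (i : ℕ) * n + j < n * n := by
      rw [Nat.succ_mul] at h1
      have := j.isLt
      omega
    rw [ival_ivPieceFn_encode J K y hlt]
    have hi : ((i : ℕ) * n + j) / n = i := by
      rw [Nat.add_comm, Nat.add_mul_div_right _ _ (Fin.pos i), Nat.div_eq_of_lt j.isLt, Nat.zero_add]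
    have hj : ((i : ℕ) * n + j) % n = j := by
      rw [Nat.add_comm, Nat.add_mul_mod_self_right, Nat.mod_eq_of_lt j.isLt]
    exact key i j _ _ hi hj
  rw [isingVerifFn, Function.comp_apply, fanoutFn_apply, zleF_boolPair, hE, Function.comp_apply, hkc, ival_ofSMFn,
    smval_encode]

end Decode

/-! ### `ISINGGROUND ∈ NP` -/

/-- The canonical witness of a configuration: its list of bits. [folklore] -/
def witnessOfSpins {n : ℕ} (σ : Fin n → Bool) : List Bool := List.ofFn σ

/-- The canonical witness decodes to the configuration. [folklore] -/
theorem spinOf_witnessOfSpins {n : ℕ} (σ : Fin n → Bool) : spinOf n (witnessOfSpins σ) = σ := by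
  funext i
  simp [spinOf, witnessOfSpins, List.getD_eq_getElem?_getD]

/-- **The certificate form of the ground-state question over `goodInstLang`.** [cite: AroraBarakCC2009, Def. 2.1] -/
def isingWitnessLang : Language Bool :=
  {x | ∃ y : List Bool, y.length ≤ (X : Polynomial ℕ).eval x.length ∧ boolPair x y ∈ isingVerifLang}

/-- `isingWitnessLang ∈ NP`. [cite: AroraBarakCC2009, Def. 2.1] -/
theorem isingWitnessLang_mem_NP : isingWitnessLang ∈ Nondeterministic.NP :=
  ⟨isingVerifLang, isingVerifLang_mem_P, X, fun _ => Iff.rfl⟩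

/-- **`ISINGGROUND` is the intersection of the code language with the certificate language**:
completeness by the canonical witness (`|List.ofFn σ| = n ≤ |x|`), soundness by the exact value of the
verifier. [cite: TroyerWiese2005, Letter p. 4] [cite: AroraBarakCC2009, Def. 2.1] -/
theorem isingGround_eq_inter : ISINGGROUND = goodInstLang ⊓ isingWitnessLang := by
  ext x
  constructor
  · rintro ⟨⟨⟨n, J⟩, K⟩, ⟨hunit, σ, hσ⟩, rfl⟩
    refine ⟨(mem_goodInstLang_iff _).2 ⟨n, J, K, rfl, hunit⟩, witnessOfSpins σ, ?_, ?_⟩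
    · have h := le_length_instEnc_encode n J K
      have hlen : (witnessOfSpins σ).length = n := by simp [witnessOfSpins]
      rw [eval_X, hlen]
      change n ≤ (instEnc.encode (⟨n, J⟩, K)).length
      rcases Nat.eq_zero_or_pos n with h0 | hpos
      · omega
      · nlinarith
    · change isingVerifFn _ = [true]
      rw [isingVerifFn_encode, spinOf_witnessOfSpins, decide_eq_true hσ]
  · rintro ⟨hgood, y, -, hacc⟩
    obtain ⟨n, J, K, rfl, hunit⟩ := (mem_goodInstLang_iff x).1 hgood
    change isingVerifFn _ = [true] at hacc
    rw [isingVerifFn_encode] at hacc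
    have hle : isingEnergy J (spinOf n y) ≤ K := of_decide_eq_true (List.cons.inj hacc).1
    exact ⟨(⟨n, J⟩, K), ⟨hunit, spinOf n y, hle⟩, rfl⟩

/-- **`ISINGGROUND ∈ NP`** (membership half of `isingGround_isNPComplete`): a `P` language
intersected with a language in certificate form over a `P` verifier (`inter_P_mem_polyExists`).
[cite: TroyerWiese2005, Letter p. 4] [cite: AroraBarakCC2009, Def. 2.1] -/
theorem isingGround_mem_NP : ISINGGROUND ∈ Nondeterministic.NP := by
  rw [isingGround_eq_inter]
  exact inter_P_mem_polyExists (K := Classes.P) (fun _ _ a b => inter_mem_P a b) goodInstLang_mem_P isingWitnessLang_mem_NP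

end Literature.Barriers.HubbardSuperconductivity

end
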